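/-
Copyright: the b2b-balaban T⁴-continuum CRUX team, row NE7b OWNER lineage `t4-ne7b-p1` (gen 123). Project licence.
-/
import Summits.QuantumFields.BalabanUV.T4Continuum.Spine.NE7b.SupTorusPerturbedPointwiseColumn
import Summits.QuantumFields.BalabanUV.T4Continuum.Spine.NE7b.SupTorusPerturbedSupNormLipschitz

/-!
# THE POINTWISE-DECAYING PROPAGATOR OF THE PERTURBED ROAD IS LIPSCHITZ IN THE POTENTIAL AND IN THE KERNEL, WITH THE SAME DECAY:
# `(H_{V₁} + K₁)u₁ = f = (H_{V₂} + K₂)u₂`, `f` supported in the block `y₀`, `|f| ≤ M`, `|V₁ − V₂| ≤ D`, `|K₁ − K₂| ≤ ηe^{−γρ_N}` ⟹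
# `e^{δρ_s(bt x, y₀)}·|u₁ x − u₂ x| ≤ C·(D + η)·M` at EVERY site, `(C, δ)` from `(d, a, λ, Λ, ε, γ)` and `C(d)` only, every mesh, every
# volume — (171)'s `ℓ^∞` Lipschitz letters UPGRADED to the weighted sup norm: `(H_{V₁} + K₁)(u₁ − u₂) = −(V₁ − V₂)u₂ − (K₁ − K₂)u₂` is a
# source with the sup profile of `u₂` ((175) §1, (172)), and (174) converts it (row NE7b, node U5c; (171)∕(172)∕(174)∕(175) BY NAME;
# [folklore])

Cell `pub-balaban`, sub-cell `t4`, spine estimate NE7b (`T4WeightBudget.RelWeightBound`; the cell's OWN estimate — NOT PRINTED in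
[Bałaban 1983–89], NOT PROVED).  Crux-route work under `Spine/NE7b/` by the row OWNER (`t4-ne7b-p1` gen 123, file (177)) under FREEZE
(0)'s crux-prover clause; NOTHING of Bałaban's is named as a Lean object, valued or asserted; no `T4Continuum/Support` leaf typed; no `def`,
no notation (the action `(H + K)u` DISPLAYED exactly as in (162)–(176)); zero `sorry`.  Imports (BY NAME): the OWNER's (175)
`…SupTorusPerturbedPointwiseColumn` (`perturbed_propagator_pointwise_decay`; through it (174) `perturbed_pointwise_decay`, (172)
`kernel_supProfile_le`), (171) `…SupTorusPerturbedSupNormLipschitz` (`perturbed_action_sub_two`).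

WHY (located).  The road's step is smooth in the background field only if its column (propagator, response, covariance) is Lipschitz in
the data `(V, K) = (u″∘φ, kernel)` in the SAME currency in which it is bounded; (171) did this on `ℓ^∞`, (143) in block `ℓ²` for `H`.  In the
pointwise-decay currency: `w = u₁ − u₂` solves `(H_{V₁} + K₁)w = g`, `g = −(V₁ − V₂)u₂ − (K₁ − K₂)u₂` ((171) `perturbed_action_sub_two`);
`|u₂| ≤ C₀Me^{−δ₀ρ_s(bt ·, y₀)}` ((175) §1), so `|(V₁ − V₂)u₂| ≤ DC₀Me^{−δ₀ρ_s}` and, by (172) at a rate `δ₀′ = min(δ₀, ½) < γ`,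
`|(K₁ − K₂)u₂| ≤ ηK_{γ−δ₀′}e^{2dδ₀′}C₀Me^{−δ₀′ρ_s}`: a source with an exponential sup profile of size `(1 + K_{γ−δ₀′}e^{2dδ₀′})C₀(D + η)M`, which
(174) (for `(V₁, K₁)`) turns into `e^{δ₁ρ_s}|w| ≤ C₁·(…)`.

WHAT IS PROVED ([folklore]; fine torus `Site d ((n+1)s)`, coarse `Site d s`, `[NeZero s]`; `(H + K)u` DISPLAYED; `bt x = σ_s(blk n (wm x))`,
`ρ_s` the `ℓ¹` circular distance; `K_α = (2∕(1 − e^{−α}))^d`):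
* §1 THE HEADLINE **`perturbed_pointwise_decay_lipschitz`**: `d ≥ 3`, `a > 0`, `λ < min(2,a)`, `Λ ≥ 0`, `ε ≥ 0`, `γ > 1`, `εK_{γ−1} ≤
  (min(2,a) − λ)∕4` ⟹ `∃ C δ > 0`: for ALL `n, s`, ALL `V₁, V₂ ∈ [−λ, Λ]` with `|V₁ − V₂| ≤ D`, ALL kernels `|K₁|, |K₂| ≤ εe^{−γρ_N}` with
  `|K₁ − K₂| ≤ ηe^{−γρ_N}` (`η ≥ 0`), every block `y₀`, every `f` supported in `y₀` with `|f| ≤ M`, `(H_{V₁} + K₁)u₁ = f`, `(H_{V₂} + K₂)u₂ = f`: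
  `e^{δρ_s(bt x, y₀)}·|u₁ x − u₂ x| ≤ C·(D + η)·M` at EVERY site.
* §2 toy (`d = 3`).

HONEST (what this is NOT).  Block sources only (profile sources are the same proof with (174) in the place of (175) §1); `d ≥ 3` only;
constants existential and far from sharp; SMALL kernels with the exact lattice Laplacian as main part; cubic periods; scalar skeleton ((A3),
NC-NE7b-α UNRULED); nothing of the covariant propagators of [B4]–[B6]; nothing of Bałaban's.  BY-NAME EFFECT ON THE WALL: NONE.  NE7b NOT
PRINTED ∕ NOT PROVED; spine PROVED 0∕9; rung (B)+1 on a FINITE torus — NOT infinite volume, NOT the mass gap, NOT Clay.  HONEST DEPENDENCY: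
continuum YM on T⁴ ⇐ BetaPertH ∧ nine spine estimates (0∕9 proved); BetaPertH ⇐ (D1) ∧ (D4) ∧ CAP+tail; G-an2-4 gates asym, D1 and NE2∕3∕4.
-/

set_option autoImplicit false

noncomputable section

namespace Summit.QuantumFields.BalabanUV.T4Continuum.NE7b.SupTorusPerturbedPointwiseLipschitz

open Real
open Literature.MathematicalPhysics.QuantumFieldTheory.Balaban1983to89
open B6QGQLower276 (X e blk B side chart mem_B sum_B sum_B_const card_cube blk_chart)
open Beta (Site siteOf windowMap siteOf_windowMap siteOf_add siteOf_sub)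
open SupTorusPerturbedResponse (kernelSum_anti)
open SupTorusPerturbedKernelProfile (kernel_supProfile_le)
open SupTorusPerturbedSupNormLipschitz (perturbed_action_sub_two)
open SupTorusPerturbedPointwiseDecay (perturbed_pointwise_decay)
open SupTorusPerturbedPointwiseColumn (perturbed_propagator_pointwise_decay)

variable {d : ℕ}

/-! ## §1. THE END: pointwise-decay Lipschitz continuity in the potential and in the kernel -/

/-- **HEADLINE — `e^{δρ_s(bt x, y₀)}·|(H_{V₁} + K₁)⁻¹f − (H_{V₂} + K₂)⁻¹f|(x) ≤ C·(‖V₁ − V₂‖_∞ + η)·‖f‖_∞` ON THE ROAD'S CLASS, `d ≥ 3`,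
every mesh, every volume**, for `f` supported in the block `y₀`, `V₁, V₂ ∈ [−λ, Λ]`, kernels `|K₁|, |K₂| ≤ εe^{−γρ_N}` (`γ > 1`, `εK_{γ−1} ≤
(min(2,a) − λ)∕4`) with `|K₁ − K₂| ≤ ηe^{−γρ_N}`: `(H_{V₁} + K₁)(u₁ − u₂) = −(V₁ − V₂)u₂ − (K₁ − K₂)u₂` ((171)), `u₂` decays pointwise
((175) §1), the kernel difference preserves the profile ((172)), and (174) finishes. [folklore] -/
theorem perturbed_pointwise_decay_lipschitz (hd : 3 ≤ d) (a : ℝ) (ha : 0 < a) {lam Lam ε γ : ℝ} (hlam : lam < min 2 a)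
    (hLam : 0 ≤ Lam) (hε : 0 ≤ ε) (hγ : 1 < γ) (hεs : ε * (2 * (1 - exp (-(γ - 1)))⁻¹) ^ d ≤ (min 2 a - lam) / 4) :
    ∃ C δ : ℝ, 0 < C ∧ 0 < δ ∧ ∀ (n s : ℕ) [NeZero s] (V₁ V₂ : Site d ((n + 1) * s) → ℝ), (∀ x, -lam ≤ V₁ x) → (∀ x, V₁ x ≤ Lam) →
      (∀ x, -lam ≤ V₂ x) → (∀ x, V₂ x ≤ Lam) → ∀ D : ℝ, (∀ x, |V₁ x - V₂ x| ≤ D) →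
      ∀ K₁ K₂ : Site d ((n + 1) * s) → Site d ((n + 1) * s) → ℝ,
      (∀ x z, |K₁ x z| ≤ ε * exp (-(γ * ∑ i, (((x i - z i).valMinAbs.natAbs : ℕ) : ℝ)))) →
      (∀ x z, |K₂ x z| ≤ ε * exp (-(γ * ∑ i, (((x i - z i).valMinAbs.natAbs : ℕ) : ℝ)))) →
      ∀ η : ℝ, 0 ≤ η → (∀ x z, |K₁ x z - K₂ x z| ≤ η * exp (-(γ * ∑ i, (((x i - z i).valMinAbs.natAbs : ℕ) : ℝ)))) →
      ∀ (y₀ : Site d s) (M : ℝ) (u₁ u₂ f : Site d ((n + 1) * s) → ℝ),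
      (∀ x, siteOf d s (blk n (windowMap d ((n + 1) * s) x)) ≠ y₀ → f x = 0) → (∀ x, |f x| ≤ M) →
      (∀ x, ((n : ℝ) + 1) ^ 2 * ∑ μ, (2 * u₁ x - u₁ (x + siteOf d ((n + 1) * s) (e μ)) - u₁ (x - siteOf d ((n + 1) * s) (e μ)))
        + a / ((n : ℝ) + 1) ^ d * ∑ q ∈ B n (blk n (windowMap d ((n + 1) * s) x)), u₁ (siteOf d ((n + 1) * s) q) + V₁ x * u₁ x
        + ∑ z, K₁ x z * u₁ z = f x) →
      (∀ x, ((n : ℝ) + 1) ^ 2 * ∑ μ, (2 * u₂ x - u₂ (x + siteOf d ((n + 1) * s) (e μ)) - u₂ (x - siteOf d ((n + 1) * s) (e μ)))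
        + a / ((n : ℝ) + 1) ^ d * ∑ q ∈ B n (blk n (windowMap d ((n + 1) * s) x)), u₂ (siteOf d ((n + 1) * s) q) + V₂ x * u₂ x
        + ∑ z, K₂ x z * u₂ z = f x) →
      ∀ x : Site d ((n + 1) * s),
        exp (δ * ∑ i, ((((siteOf d s (blk n (windowMap d ((n + 1) * s) x))) i - y₀ i).valMinAbs.natAbs : ℕ) : ℝ)) * |u₁ x - u₂ x|
          ≤ C * (D + η) * M := by
  classical
  have hdR : (0 : ℝ) ≤ d := Nat.cast_nonneg d
  -- `u₂` decays pointwise ((175) §1); the rate `δ₀′ = min(δ₀, ½) < γ` for the kernel letter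
  obtain ⟨C₀, δ₀, hC₀, hδ₀, H0⟩ := perturbed_propagator_pointwise_decay (d := d) hd a ha hlam hLam hε hγ hεs
  set δ₀' : ℝ := min δ₀ (1 / 2) with hδ₀'_def
  have hδ₀'0 : 0 < δ₀' := lt_min hδ₀ (by norm_num)
  have hδ₀'δ₀ : δ₀' ≤ δ₀ := min_le_left _ _
  have hδ₀'γ : δ₀' < γ := lt_of_le_of_lt ((min_le_right _ _).trans (by norm_num)) hγ
  set Kγ' : ℝ := (2 * (1 - exp (-(γ - δ₀')))⁻¹) ^ d * exp (2 * d * δ₀') with hKγ'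
  have hKγ'0 : 0 ≤ Kγ' :=
    mul_nonneg (pow_nonneg (mul_nonneg zero_le_two (inv_nonneg.2 (sub_nonneg.2 (exp_le_one_iff.2 (by linarith))))) d) (exp_pos _).le
  -- (174) for sources with the profile rate `δ₀′`
  obtain ⟨C₁, δ₁, hC₁, hδ₁, H1⟩ := perturbed_pointwise_decay (d := d) hd a ha hlam hLam hδ₀'0 hε hγ hεs
  refine ⟨C₁ * (1 + Kγ') * C₀, δ₁, by positivity, hδ₁, ?_⟩
  intro n s _ V₁ V₂ hV₁ hV₁' hV₂ hV₂' D hD K₁ K₂ hK₁ hK₂ η hη hK12 y₀ M u₁ u₂ f hf hfM hu₁ hu₂ x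
  have hM : 0 ≤ M := (abs_nonneg _).trans (hfM x)
  have hD0 : 0 ≤ D := (abs_nonneg _).trans (hD x)
  -- `|u₂| ≤ C₀Me^{−δ₀′ρ_s(bt ·, y₀)}`
  have hu₂dec : ∀ x', |u₂ x'| ≤ (C₀ * M)
      * exp (-(δ₀' * ∑ i, ((((siteOf d s (blk n (windowMap d ((n + 1) * s) x'))) i - y₀ i).valMinAbs.natAbs : ℕ) : ℝ))) := fun x' => by
    have h := H0 n s V₂ hV₂ hV₂' K₂ hK₂ y₀ M u₂ f hf hfM hu₂ x'
    have hρ : 0 ≤ ∑ i, ((((siteOf d s (blk n (windowMap d ((n + 1) * s) x'))) i - y₀ i).valMinAbs.natAbs : ℕ) : ℝ) :=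
      Finset.sum_nonneg fun _ _ => Nat.cast_nonneg _
    rw [exp_neg, ← div_eq_mul_inv, le_div_iff₀ (exp_pos _), mul_comm]
    refine le_trans ?_ h
    refine mul_le_mul_of_nonneg_right (exp_le_exp.2 ?_) (abs_nonneg _)
    exact mul_le_mul_of_nonneg_right hδ₀'δ₀ hρ
  -- the kernel difference preserves the profile ((172))
  have hKu : ∀ x', |∑ z, (K₁ x' z - K₂ x' z) * u₂ z| ≤ η * Kγ' * (C₀ * M)
      * exp (-(δ₀' * ∑ i, ((((siteOf d s (blk n (windowMap d ((n + 1) * s) x'))) i - y₀ i).valMinAbs.natAbs : ℕ) : ℝ))) := fun x' => by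
    have h := kernel_supProfile_le n s hη hδ₀'0.le hδ₀'γ (fun x z => K₁ x z - K₂ x z) hK12 y₀ u₂ hu₂dec x'
    rw [hKγ']
    calc _ ≤ _ := h
      _ = _ := by ring
  -- `(H_{V₁} + K₁)(u₁ − u₂) = −(V₁ − V₂)u₂ − (K₁ − K₂)u₂`, a source with the profile of `u₂`
  have hw := perturbed_action_sub_two n a s V₁ V₂ K₁ K₂ u₁ u₂ f hu₁ hu₂
  have hsrc : ∀ x', |-((V₁ x' - V₂ x') * u₂ x') - ∑ z, (K₁ x' z - K₂ x' z) * u₂ z|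
      ≤ (1 + Kγ') * C₀ * ((D + η) * M)
        * exp (-(δ₀' * ∑ i, ((((siteOf d s (blk n (windowMap d ((n + 1) * s) x'))) i - y₀ i).valMinAbs.natAbs : ℕ) : ℝ))) := by
    intro x'
    have hE := exp_pos (-(δ₀' * ∑ i, ((((siteOf d s (blk n (windowMap d ((n + 1) * s) x'))) i - y₀ i).valMinAbs.natAbs : ℕ) : ℝ)))
    have k1 : |-((V₁ x' - V₂ x') * u₂ x')| ≤ D * ((C₀ * M)
        * exp (-(δ₀' * ∑ i, ((((siteOf d s (blk n (windowMap d ((n + 1) * s) x'))) i - y₀ i).valMinAbs.natAbs : ℕ) : ℝ)))) := by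
      rw [abs_neg, abs_mul]; exact mul_le_mul (hD x') (hu₂dec x') (abs_nonneg _) hD0
    have k2 := hKu x'
    have k3 : D * (C₀ * M) + η * Kγ' * (C₀ * M) ≤ (1 + Kγ') * C₀ * ((D + η) * M) := by
      have e1 : (1 + Kγ') * C₀ * ((D + η) * M) = D * (C₀ * M) + η * Kγ' * (C₀ * M) + (D * Kγ' + η) * (C₀ * M) := by ring
      rw [e1]
      have : 0 ≤ (D * Kγ' + η) * (C₀ * M) := by positivity
      linarith
    calc |-((V₁ x' - V₂ x') * u₂ x') - ∑ z, (K₁ x' z - K₂ x' z) * u₂ z|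
        ≤ |-((V₁ x' - V₂ x') * u₂ x')| + |∑ z, (K₁ x' z - K₂ x' z) * u₂ z| := abs_sub _ _
      _ ≤ D * ((C₀ * M) * exp (-(δ₀' * ∑ i, ((((siteOf d s (blk n (windowMap d ((n + 1) * s) x'))) i - y₀ i).valMinAbs.natAbs : ℕ) : ℝ))))
          + η * Kγ' * (C₀ * M)
          * exp (-(δ₀' * ∑ i, ((((siteOf d s (blk n (windowMap d ((n + 1) * s) x'))) i - y₀ i).valMinAbs.natAbs : ℕ) : ℝ))) := add_le_add k1 k2
      _ = (D * (C₀ * M) + η * Kγ' * (C₀ * M))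
          * exp (-(δ₀' * ∑ i, ((((siteOf d s (blk n (windowMap d ((n + 1) * s) x'))) i - y₀ i).valMinAbs.natAbs : ℕ) : ℝ))) := by ring
      _ ≤ _ := mul_le_mul_of_nonneg_right k3 hE.le
  have h := H1 n s V₁ hV₁ hV₁' K₁ hK₁ y₀ ((1 + Kγ') * C₀ * ((D + η) * M)) (fun x' => u₁ x' - u₂ x')
    (fun x' => -((V₁ x' - V₂ x') * u₂ x') - ∑ z, (K₁ x' z - K₂ x' z) * u₂ z) hsrc hw x
  refine h.trans (le_of_eq ?_)
  ring

/-! ## §2. Toy -/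

/-- Toy (`d = 3`, `a = 1`, `λ = 0`, `Λ = 1`, `ε = 0`, `γ = 2`): the constants of the pointwise Lipschitz letter exist. -/
example : ∃ C δ : ℝ, 0 < C ∧ 0 < δ :=
  let ⟨C, δ, hC, hδ, _⟩ := perturbed_pointwise_decay_lipschitz (d := 3) le_rfl 1 one_pos (lam := 0) (Lam := 1) (ε := 0) (γ := 2)
    (by rw [min_eq_right (by norm_num : (1 : ℝ) ≤ 2)]; norm_num) zero_le_one le_rfl (by norm_num)
    (by rw [min_eq_right (by norm_num : (1 : ℝ) ≤ 2)]; norm_num)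
  ⟨C, δ, hC, hδ⟩

end Summit.QuantumFields.BalabanUV.T4Continuum.NE7b.SupTorusPerturbedPointwiseLipschitz
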